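import Mathlib.Analysis.InnerProductSpace.EuclideanDist
import Mathlib.Geometry.Euclidean.Angle.Unoriented.Basic
import Literature.Analysis.FluidPDE.VorticityDoubleConeRegularity
import Literature.Analysis.FluidPDE.SuitableWeakInBallTools
import Literature.Analysis.FluidPDE.BlowupFarField
import Literature.Analysis.FluidPDE.BarkerPrangeConcentrationProofs
import Literature.Analysis.FluidPDE.DirectionDissipation
import HarnessLib

/-!
# Lei–Ren–Tian 2025, Theorem 1.1: the printed reductions (Remark 1.2 and the apex form)

Analysis/FluidPDE proofs-only file (no definitions, no named facts) next to
`VorticityDoubleConeRegularity.lean`, which vendors Z. Lei, X. Ren, G. Tian, *A geometric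
characterization of potential Navier–Stokes singularities*, arXiv:2501.08976 (2025), Thm. 1.1 as
the named fact `LeiRenTian2025_doubleCone_regularity`. This file proves, sorry-free, the two
reductions with which the printed proof opens and closes, so that a proof of the analytic core
(Lemmas 3.1–3.2, the blow-up procedure and Proposition 3.3 with §4, pp. 8–12 — NOT here) can be
written for one normalised situation only:

* **Remark 1.2 (p. 4), the cone condition in algebraic form.** For a unit vector `e` and any
  `ω ≠ 0` with direction `ξ = ω/|ω|`: `|ξ × e|² + ⟨ξ, e⟩² = 1` (Lagrange's identity), hence
  `|ξ × e| ≤ 1 - δ` gives `√(δ(2-δ)) |ω| ≤ |⟨ω, e⟩|` and `|ω - ⟨ω,e⟩e| ≤ (1-δ)|ω|`, i.e. the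
  printed `|ω_h| ≤ C |ω₃|` with `C = (1-δ)/√(2δ-δ²)` when `e = e₃`
  (`LeiRenTian2025.sqrt_mul_norm_le_abs_inner_of_cross_le`,
  `LeiRenTian2025.norm_sub_inner_smul_le_of_cross_le`,
  `LeiRenTian2025.norm_sub_inner_smul_le_const_mul_abs_inner`); and the dichotomy
  "`|ω| ≤ M` or `|ξ × e| ≤ 1 - δ`" of Thm. 1.1 gives the printed working hypothesis (1.6)
  `|ω| ≤ C |⟨ω, e⟩| + M` with `C = 1/√(δ(2-δ))` (`LeiRenTian2025.norm_le_of_dichotomy`).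
* **The apex form (proof of Thm. 1.1, p. 10, and §3 ¶2, p. 8: translate and rescale).** The
  hypotheses of Thm. 1.1 are covariant under the Navier–Stokes zoom
  `U(s, y) = R u(t₁ + R² s, x₁ + R y)` (`R • stPull (R^2) R t₁ x₁ u`): the class
  `IsSuitableWeakSolutionInBall` (accepted: `IsSuitableWeakSolutionInBall.zoom`), backward
  regular points (`LeiRenTian2025.isBackwardSingularPoint_zoom_iff`), the representative
  convention (`LeiRenTian2025.IsClassicalAtRegularPoints.zoom`) and the cone dichotomy, with
  `M` replaced by `R² M` (`LeiRenTian2025.cone_zoom`: `curl U = R² curl u ∘ Φ`, directions are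
  unchanged). Consequently Thm. 1.1 as vendored (conclusion on the closed cylinder
  `\overline{Q(1/2)}`) is EQUIVALENT to its apex form "… then the origin is a regular point"
  (`LeiRenTian2025_doubleCone_regularity_iff_apex`: for `z₀ ∈ \overline{Q(1/2)}` one has
  `Q(z₀, 1/2) ⊆ Q(1)`, and the zoom with `R = 1/2` about `z₀` carries `Q(z₀, 1/2)` to `Q(1)`),
  and it FOLLOWS from the apex form stated under the algebraic hypothesis (1.6)
  (`LeiRenTian2025_doubleCone_regularity_of_apex_linearCone`).

What this file is NOT: it does not prove `LeiRenTian2025_doubleCone_regularity`; the analytic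
core of the paper (absolute vorticity flux bound, uniform Type I bound via Biot–Savart and
Seregin–Šverák, blow-up, Kato's inequality for `|ω₃|` and the De Giorgi–Nash–Moser decay of the
flux, ε-regularity) is the hypothesis `h` of `LeiRenTian2025_doubleCone_regularity_of_apex_linearCone`.

## References

* Z. Lei, X. Ren, G. Tian, arXiv:2501.08976 (2025): Thm. 1.1 and Rmk. 1.2 (p. 4), §2 Rmk. 2.1
  (p. 6), §3 ¶2 (p. 8, the translated and rescaled solution), end of §3 (p. 10). [LeiRenTian2025]
* L. Caffarelli, R. Kohn, L. Nirenberg, Comm. Pure Appl. Math. 35 (1982), §2 (parabolic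
  cylinders and the Navier–Stokes scaling). [CaffarelliKohnNirenberg1982]
-/

noncomputable section

open MeasureTheory Set Function Filter Metric
open scoped InnerProductSpace RealInnerProductSpace ENNReal NNReal Topology

namespace Literature.Analysis.FluidPDE

namespace LeiRenTian2025

/-! ### Remark 1.2: the cone condition in algebraic form -/

section Algebra

/-- **Lagrange's identity in `ℝ³`**: `|a × b|² + ⟨a, b⟩² = |a|² |b|²`
(`|a × b| = |a||b| sin∠(a,b)`, `⟨a,b⟩ = |a||b| cos∠(a,b)`); the computation behind Remark 1.2
("the assumption of Theorem 1.1 is equivalent to `|ω_h| ≤ C|ω₃|`").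
[cite: LeiRenTian2025, Rmk. 1.2 (arXiv:2501.08976, p. 4)] -/
theorem norm_cross_sq_add_inner_sq (a b : EuclideanSpace ℝ (Fin 3)) :
    ‖cross a b‖ ^ 2 + ⟪a, b⟫_ℝ ^ 2 = ‖a‖ ^ 2 * ‖b‖ ^ 2 := by
  rw [norm_cross, ← InnerProductGeometry.cos_angle_mul_norm_mul_norm a b]
  have h := Real.sin_sq_add_cos_sq (InnerProductGeometry.angle a b)
  nlinarith [h]

variable {ω e : EuclideanSpace ℝ (Fin 3)} {δ : ℝ}

/-- For a unit vector `e` and `ω ≠ 0` with direction `ξ = ω/|ω|`: `|ξ × e|² + ⟨ξ, e⟩² = 1`.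
[cite: LeiRenTian2025, Rmk. 1.2 (arXiv:2501.08976, p. 4)] -/
theorem norm_cross_direction_sq_add_inner_sq (he : ‖e‖ = 1) (hω : ω ≠ 0) :
    ‖cross (‖ω‖⁻¹ • ω) e‖ ^ 2 + ⟪‖ω‖⁻¹ • ω, e⟫_ℝ ^ 2 = 1 := by
  have hn : ‖‖ω‖⁻¹ • ω‖ = 1 := by
    rw [norm_smul, norm_inv, norm_norm, inv_mul_cancel₀ (norm_ne_zero_iff.2 hω)]
  rw [norm_cross_sq_add_inner_sq, hn, he]
  norm_num

/-- **Remark 1.2, the vertical component dominates**: if `|e| = 1`, `ω ≠ 0` and the direction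
`ξ = ω/|ω|` satisfies `|ξ × e| ≤ 1 - δ`, then `√(δ(2-δ)) |ω| ≤ |⟨ω, e⟩|` (for `e = e₃`:
`|ω| ≤ |ω₃| / √(2δ - δ²)`). [cite: LeiRenTian2025, Rmk. 1.2 (arXiv:2501.08976, p. 4)] -/
theorem sqrt_mul_norm_le_abs_inner_of_cross_le (he : ‖e‖ = 1) (hω : ω ≠ 0)
    (hcone : ‖cross (‖ω‖⁻¹ • ω) e‖ ≤ 1 - δ) :
    Real.sqrt (δ * (2 - δ)) * ‖ω‖ ≤ |⟪ω, e⟫_ℝ| := by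
  have hnpos : 0 < ‖ω‖ := norm_pos_iff.2 hω
  have hid := norm_cross_direction_sq_add_inner_sq he hω
  have hξ : ⟪‖ω‖⁻¹ • ω, e⟫_ℝ = ‖ω‖⁻¹ * ⟪ω, e⟫_ℝ := real_inner_smul_left _ _ _
  -- `⟨ξ, e⟩² ≥ δ(2 - δ)`
  have hsq : δ * (2 - δ) ≤ (‖ω‖⁻¹ * ⟪ω, e⟫_ℝ) ^ 2 := by
    have h0 : 0 ≤ ‖cross (‖ω‖⁻¹ • ω) e‖ := norm_nonneg _
    have h1 : ‖cross (‖ω‖⁻¹ • ω) e‖ ^ 2 ≤ (1 - δ) ^ 2 := pow_le_pow_left₀ h0 hcone 2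
    rw [← hξ]
    nlinarith [hid, h1]
  have hsq' : Real.sqrt (δ * (2 - δ)) ≤ |‖ω‖⁻¹ * ⟪ω, e⟫_ℝ| := by
    rw [← Real.sqrt_sq_eq_abs]
    exact Real.sqrt_le_sqrt hsq
  rw [abs_mul, abs_inv, abs_norm] at hsq'
  calc Real.sqrt (δ * (2 - δ)) * ‖ω‖ ≤ ‖ω‖⁻¹ * |⟪ω, e⟫_ℝ| * ‖ω‖ :=
        mul_le_mul_of_nonneg_right hsq' hnpos.le
    _ = |⟪ω, e⟫_ℝ| := by field_simp

/-- **Remark 1.2, the horizontal component is small**: if `|e| = 1`, `ω ≠ 0` and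
`|ξ × e| ≤ 1 - δ` for `ξ = ω/|ω|`, then `|ω - ⟨ω, e⟩ e| ≤ (1 - δ) |ω|` (the component of `ω`
orthogonal to `e`; for `e = e₃` this is `|ω_h| ≤ (1-δ)|ω|`).
[cite: LeiRenTian2025, Rmk. 1.2 (arXiv:2501.08976, p. 4)] -/
theorem norm_sub_inner_smul_le_of_cross_le (he : ‖e‖ = 1) (hω : ω ≠ 0)
    (hcone : ‖cross (‖ω‖⁻¹ • ω) e‖ ≤ 1 - δ) :
    ‖ω - ⟪ω, e⟫_ℝ • e‖ ≤ (1 - δ) * ‖ω‖ := by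
  have hnpos : 0 < ‖ω‖ := norm_pos_iff.2 hω
  have h0 : 0 ≤ ‖cross (‖ω‖⁻¹ • ω) e‖ := norm_nonneg _
  have h1δ : 0 ≤ 1 - δ := h0.trans hcone
  have hid := norm_cross_direction_sq_add_inner_sq he hω
  have hξ : ⟪‖ω‖⁻¹ • ω, e⟫_ℝ = ‖ω‖⁻¹ * ⟪ω, e⟫_ℝ := real_inner_smul_left _ _ _
  -- `|ω - ⟨ω,e⟩e|² = |ω|² - ⟨ω,e⟩²`
  have hexp : ‖ω - ⟪ω, e⟫_ℝ • e‖ ^ 2 = ‖ω‖ ^ 2 - ⟪ω, e⟫_ℝ ^ 2 := by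
    rw [← real_inner_self_eq_norm_sq, ← real_inner_self_eq_norm_sq, inner_sub_left,
      inner_sub_right, inner_sub_right, real_inner_smul_left, real_inner_smul_right,
      real_inner_smul_left, real_inner_smul_right, real_inner_self_eq_norm_sq e, he,
      real_inner_comm e ω]
    ring
  -- `⟨ω,e⟩² = |ω|² ⟨ξ,e⟩² ≥ |ω|² (1 - (1-δ)²)`
  have hcr : ‖cross (‖ω‖⁻¹ • ω) e‖ ^ 2 ≤ (1 - δ) ^ 2 := pow_le_pow_left₀ h0 hcone 2
  have hin : ⟪ω, e⟫_ℝ ^ 2 = ‖ω‖ ^ 2 * ⟪‖ω‖⁻¹ • ω, e⟫_ℝ ^ 2 := by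
    rw [hξ]; field_simp
  have hsq : ‖ω - ⟪ω, e⟫_ℝ • e‖ ^ 2 ≤ ((1 - δ) * ‖ω‖) ^ 2 := by
    rw [hexp, hin]
    nlinarith [hid, hcr, sq_nonneg ‖ω‖]
  exact (pow_le_pow_iff_left₀ (norm_nonneg _) (mul_nonneg h1δ hnpos.le) two_ne_zero).1 hsq

/-- **Remark 1.2 as printed**: `|e| = 1`, `ω ≠ 0`, `δ > 0` and `|ξ × e| ≤ 1 - δ` (`ξ = ω/|ω|`)
imply `|ω - ⟨ω,e⟩e| ≤ C |⟨ω, e⟩|` with `C = (1 - δ)/√(2δ - δ²)` ("`|ω_h| ≤ C |ω₃|`" for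
`e = e₃`). [cite: LeiRenTian2025, Rmk. 1.2 (arXiv:2501.08976, p. 4)] -/
theorem norm_sub_inner_smul_le_const_mul_abs_inner (he : ‖e‖ = 1) (hω : ω ≠ 0) (hδ : 0 < δ)
    (hcone : ‖cross (‖ω‖⁻¹ • ω) e‖ ≤ 1 - δ) :
    ‖ω - ⟪ω, e⟫_ℝ • e‖ ≤ (1 - δ) / Real.sqrt (2 * δ - δ ^ 2) * |⟪ω, e⟫_ℝ| := by
  have h0 : 0 ≤ ‖cross (‖ω‖⁻¹ • ω) e‖ := norm_nonneg _
  have h1δ : 0 ≤ 1 - δ := h0.trans hcone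
  have hpos : 0 < 2 * δ - δ ^ 2 := by nlinarith
  have hs : 0 < Real.sqrt (2 * δ - δ ^ 2) := Real.sqrt_pos.2 hpos
  have hv := sqrt_mul_norm_le_abs_inner_of_cross_le he hω hcone
  have heq : δ * (2 - δ) = 2 * δ - δ ^ 2 := by ring
  rw [heq] at hv
  have hh := norm_sub_inner_smul_le_of_cross_le he hω hcone
  rw [div_mul_eq_mul_div, le_div_iff₀ hs]
  calc ‖ω - ⟪ω, e⟫_ℝ • e‖ * Real.sqrt (2 * δ - δ ^ 2)
      ≤ (1 - δ) * ‖ω‖ * Real.sqrt (2 * δ - δ ^ 2) :=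
        mul_le_mul_of_nonneg_right hh (Real.sqrt_nonneg _)
    _ = (1 - δ) * (Real.sqrt (2 * δ - δ ^ 2) * ‖ω‖) := by ring
    _ ≤ (1 - δ) * |⟪ω, e⟫_ℝ| := mul_le_mul_of_nonneg_left hv h1δ

/-- **The working hypothesis (1.6) of the printed proof.** For a unit vector `e`, `δ > 0` and
`M ≥ 0`, the dichotomy of Thm. 1.1 — "`|ω| ≤ M` or `|ξ × e| ≤ 1 - δ`" (`ξ = ω/|ω|`) — implies
`|ω| ≤ C |⟨ω, e⟩| + M` with `C = 1/√(δ(2-δ))` ("Hence, to prove Theorem 1.1, it is sufficient to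
work under the condition that `|ω| ≤ C|ω₃| + M` at all regular points").
[cite: LeiRenTian2025, Rmk. 1.2, (1.6) (arXiv:2501.08976, p. 4)] -/
theorem norm_le_of_dichotomy {M : ℝ} (he : ‖e‖ = 1) (hδ : 0 < δ) (hM : 0 ≤ M)
    (h : ‖ω‖ ≤ M ∨ ‖cross (‖ω‖⁻¹ • ω) e‖ ≤ 1 - δ) :
    ‖ω‖ ≤ (Real.sqrt (δ * (2 - δ)))⁻¹ * |⟪ω, e⟫_ℝ| + M := by
  have hC : 0 ≤ (Real.sqrt (δ * (2 - δ)))⁻¹ * |⟪ω, e⟫_ℝ| := by positivity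
  rcases h with h | h
  · linarith
  · by_cases hω : ω = 0
    · rw [hω, norm_zero]; positivity
    have h1δ : 0 ≤ 1 - δ := (norm_nonneg _).trans h
    have hpos : 0 < δ * (2 - δ) := by nlinarith
    have hs : 0 < Real.sqrt (δ * (2 - δ)) := Real.sqrt_pos.2 hpos
    have hv := sqrt_mul_norm_le_abs_inner_of_cross_le he hω h
    have : ‖ω‖ ≤ (Real.sqrt (δ * (2 - δ)))⁻¹ * |⟪ω, e⟫_ℝ| := by
      rw [inv_mul_eq_div, le_div_iff₀' hs]
      exact hv
    linarith

end Algebra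

/-! ### Covariance of the hypotheses of Theorem 1.1 under the Navier–Stokes zoom

The zoom about `(t₁, x₁)` at scale `R > 0` is `U(s, y) = R u(t₁ + R² s, x₁ + R y)`, i.e.
`U = R • stPull (R ^ 2) R t₁ x₁ u`, along `Φ = stAffine (R ^ 2) R t₁ x₁`,
`Φ(s, y) = (t₁ + R² s, x₁ + R y)` (`SpaceTimeRescaling.lean`; §3 ¶2 of the paper uses
`R = δ/10`, the end of §3 uses `R = r_k ↓ 0`, and the passage from the apex to a point of
`\overline{Q(1/2)}` uses `R = 1/2`). -/

section Zoom

variable {R : ℝ} {u : ℝ → EuclideanSpace ℝ (Fin 3) → EuclideanSpace ℝ (Fin 3)}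

/-- `Φ⁻¹(Q(Φ w, R r)) = Q(w, r)` for `Φ = stAffine R² R t₁ x₁`, `R > 0` (CKN 1982, §2: the
cylinders `Q_r` are adapted to the parabolic scaling). [cite: CaffarelliKohnNirenberg1982, §2 (parabolic cylinders and scaling)] -/
theorem stAffine_preimage_parabolicCylinder_stAffine (hR : 0 < R) (t₁ : ℝ)
    (x₁ : EuclideanSpace ℝ (Fin 3)) (r : ℝ) (w : ℝ × EuclideanSpace ℝ (Fin 3)) :
    stAffine (R ^ 2) R t₁ x₁ ⁻¹' parabolicCylinder (R * r) (stAffine (R ^ 2) R t₁ x₁ w) =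
      parabolicCylinder r w := by
  have hR2 : 0 < R ^ 2 := by positivity
  rw [parabolicCylinder, stAffine_fst, stAffine_snd, stAffine_preimage_cylinder hR2 hR,
    parabolicCylinder]
  congr 1
  · congr 1
    · field_simp
      ring
    · field_simp
      ring
  · congr 1
    · rw [add_sub_cancel_left, smul_smul, inv_mul_cancel₀ hR.ne', one_smul]
    · field_simp

/-- **Essential suprema under the zoom**: `‖U‖_{L^∞(Q(w, ρ))} = R ‖u‖_{L^∞(Q(Φ w, R ρ))}` for
`U = R u ∘ Φ` (CKN 1982, §2: the cylinders `Q_r` and `L^∞` bounds under the scaling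
`u_λ(x,t) = λ u(λx, λ²t)`). [cite: CaffarelliKohnNirenberg1982, §2 (parabolic cylinders and scaling)] -/
theorem eLpNorm_top_zoom_parabolicCylinder (hR : 0 < R) (t₁ : ℝ) (x₁ : EuclideanSpace ℝ (Fin 3))
    (u : ℝ → EuclideanSpace ℝ (Fin 3) → EuclideanSpace ℝ (Fin 3)) (ρ : ℝ)
    (w : ℝ × EuclideanSpace ℝ (Fin 3)) :
    eLpNorm (uncurry (R • stPull (R ^ 2) R t₁ x₁ u)) ∞ (volume.restrict (parabolicCylinder ρ w)) =
      ‖R‖ₑ * eLpNorm (uncurry u) ∞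
        (volume.restrict (parabolicCylinder (R * ρ) (stAffine (R ^ 2) R t₁ x₁ w))) := by
  rw [← stAffine_preimage_parabolicCylinder_stAffine hR t₁ x₁ ρ w]
  exact eLpNorm_top_uncurry_smul_stPull_preimage (pow_pos hR 2) hR t₁ x₁ R u _

/-- **Regular points correspond under the zoom**: `w` is a backward singular point of
`U = R u ∘ Φ` iff `Φ w` is a backward singular point of `u` (`R > 0`).
[cite: LeiRenTian2025, §3 ¶2 (arXiv:2501.08976, p. 8: "would still satisfy the conditions of Theorem 1.1")] -/
theorem isBackwardSingularPoint_zoom_iff (hR : 0 < R) (t₁ : ℝ) (x₁ : EuclideanSpace ℝ (Fin 3))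
    (u : ℝ → EuclideanSpace ℝ (Fin 3) → EuclideanSpace ℝ (Fin 3))
    (w : ℝ × EuclideanSpace ℝ (Fin 3)) :
    IsBackwardSingularPoint (R • stPull (R ^ 2) R t₁ x₁ u) w ↔
      IsBackwardSingularPoint u (stAffine (R ^ 2) R t₁ x₁ w) := by
  have hRe : (‖R‖ₑ : ℝ≥0∞) ≠ 0 := by
    rw [enorm_ne_zero]; exact hR.ne'
  have hRe' : (‖R‖ₑ : ℝ≥0∞) ≠ ∞ := enorm_ne_top
  have hmul : ∀ a : ℝ≥0∞, ‖R‖ₑ * a = ∞ ↔ a = ∞ := fun a => by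
    rw [ENNReal.mul_eq_top]
    constructor
    · rintro (⟨-, h⟩ | ⟨h, -⟩)
      · exact h
      · exact absurd h hRe'
    · exact fun h => Or.inl ⟨hRe, h⟩
  unfold IsBackwardSingularPoint
  constructor
  · intro h r hr
    have h1 := h (r / R) (div_pos hr hR)
    rw [eLpNorm_top_zoom_parabolicCylinder hR, mul_div_cancel₀ _ hR.ne', hmul] at h1
    exact h1
  · intro h ρ hρ
    rw [eLpNorm_top_zoom_parabolicCylinder hR, hmul]
    exact h (R * ρ) (mul_pos hR hρ)

/-- **The representative convention is transported by the zoom**: if `u` is continuous and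
slice-wise differentiable at its regular points in `Q`, then `U = R u ∘ Φ` is so at its regular
points in `Φ⁻¹(Q)` (`R > 0`) — the translated and rescaled solution "would still satisfy the
conditions of Theorem 1.1". [cite: LeiRenTian2025, §3 ¶2 (arXiv:2501.08976, p. 8)] -/
theorem IsClassicalAtRegularPoints.zoom (hR : 0 < R) {Q : Set (ℝ × EuclideanSpace ℝ (Fin 3))}
    (h : IsClassicalAtRegularPoints u Q) (t₁ : ℝ) (x₁ : EuclideanSpace ℝ (Fin 3)) :
    IsClassicalAtRegularPoints (R • stPull (R ^ 2) R t₁ x₁ u) (stAffine (R ^ 2) R t₁ x₁ ⁻¹' Q) := by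
  intro w hw hreg
  have hreg' : ¬ IsBackwardSingularPoint u (stAffine (R ^ 2) R t₁ x₁ w) := by
    rwa [← isBackwardSingularPoint_zoom_iff hR]
  obtain ⟨hc, hd⟩ := h _ hw hreg'
  refine ⟨?_, ?_⟩
  · have hU : uncurry (R • stPull (R ^ 2) R t₁ x₁ u) =
        fun z => R • uncurry u (stAffine (R ^ 2) R t₁ x₁ z) := by
      funext z; rfl
    rw [hU]
    exact (hc.comp (continuous_stAffine _ _ _ _).continuousAt).const_smul R
  · have hU : (R • stPull (R ^ 2) R t₁ x₁ u) w.1 =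
        fun y => R • u (t₁ + R ^ 2 * w.1) (x₁ + R • y) := by
      funext y; rfl
    rw [hU]
    have hd' : DifferentiableAt ℝ (u (t₁ + R ^ 2 * w.1)) (x₁ + R • w.2) := by
      simpa only [stAffine_fst, stAffine_snd] using hd
    have haff : DifferentiableAt ℝ (fun y : EuclideanSpace ℝ (Fin 3) => x₁ + R • y) w.2 :=
      (differentiableAt_const _).add (differentiableAt_id.const_smul R)
    exact (hd'.comp w.2 haff).const_smul R

/-- **The vorticity under the zoom**: `curl U(s, ·)(y) = R² curl u(t, ·)(x)` at
`(t, x) = Φ(s, y)` (chain rule; no differentiability needed). [cite: LeiRenTian2025, end of §3 (arXiv:2501.08976, p. 10: `ω^{(r)} = r² ω(r x, r² t)`)] -/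
theorem curl_zoom (R t₁ : ℝ) (x₁ : EuclideanSpace ℝ (Fin 3))
    (u : ℝ → EuclideanSpace ℝ (Fin 3) → EuclideanSpace ℝ (Fin 3)) (s : ℝ)
    (y : EuclideanSpace ℝ (Fin 3)) :
    curl ((R • stPull (R ^ 2) R t₁ x₁ u) s) y = R ^ 2 • curl (u (t₁ + R ^ 2 * s)) (x₁ + R • y) := by
  rw [curl_smul_stPull, ← pow_two]

/-- **The vorticity direction is invariant under the zoom** (`R > 0`): `ξ_U(s, ·)(y) = ξ_u(t, ·)(x)`
at `(t, x) = Φ(s, y)` (so the cone condition on `ξ` passes to every rescaled solution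
`v^{(r)}`). [cite: LeiRenTian2025, end of §3 (arXiv:2501.08976, p. 10)] -/
theorem vorticityDirection_curl_zoom (hR : 0 < R) (t₁ : ℝ) (x₁ : EuclideanSpace ℝ (Fin 3))
    (u : ℝ → EuclideanSpace ℝ (Fin 3) → EuclideanSpace ℝ (Fin 3)) (s : ℝ)
    (y : EuclideanSpace ℝ (Fin 3)) :
    vorticityDirection (curl ((R • stPull (R ^ 2) R t₁ x₁ u) s)) y =
      vorticityDirection (curl (u (t₁ + R ^ 2 * s))) (x₁ + R • y) := by
  have hcurl : curl ((R • stPull (R ^ 2) R t₁ x₁ u) s) =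
      fun y => R ^ 2 • curl (u (t₁ + R ^ 2 * s)) (x₁ + R • y) :=
    funext (curl_zoom R t₁ x₁ u s)
  rw [hcurl, vorticityDirection_const_smul (pow_pos hR 2)]
  rfl

/-- **The cone dichotomy is transported by the zoom**, with the threshold `M` replaced by `R² M`:
if at every regular point of `u` in `Q` either `|ω| ≤ M` or `|ξ × e| ≤ 1 - δ`, then at every
regular point of `U = R u ∘ Φ` in `Φ⁻¹(Q)` either `|ω_U| ≤ R² M` or `|ξ_U × e| ≤ 1 - δ`.
[cite: LeiRenTian2025, §3 ¶2 and end of §3 (arXiv:2501.08976, pp. 8, 10: `|ω^{(r_k)}| ≤ C|ω^{(r_k)}_3| + M r_k²`)] -/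
theorem cone_zoom (hR : 0 < R) {t₁ : ℝ} {x₁ : EuclideanSpace ℝ (Fin 3)}
    {Q : Set (ℝ × EuclideanSpace ℝ (Fin 3))} {e : EuclideanSpace ℝ (Fin 3)} {δ M : ℝ}
    (h : ∀ z ∈ Q, ¬ IsBackwardSingularPoint u z →
      ‖curl (u z.1) z.2‖ ≤ M ∨ ‖cross (vorticityDirection (curl (u z.1)) z.2) e‖ ≤ 1 - δ) :
    ∀ w ∈ stAffine (R ^ 2) R t₁ x₁ ⁻¹' Q, ¬ IsBackwardSingularPoint (R • stPull (R ^ 2) R t₁ x₁ u) w →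
      ‖curl ((R • stPull (R ^ 2) R t₁ x₁ u) w.1) w.2‖ ≤ R ^ 2 * M ∨
        ‖cross (vorticityDirection (curl ((R • stPull (R ^ 2) R t₁ x₁ u) w.1)) w.2) e‖ ≤ 1 - δ := by
  intro w hw hreg
  have hreg' : ¬ IsBackwardSingularPoint u (stAffine (R ^ 2) R t₁ x₁ w) := by
    rwa [← isBackwardSingularPoint_zoom_iff hR]
  rcases h _ hw hreg' with h1 | h2
  · left
    rw [curl_zoom, norm_smul, Real.norm_eq_abs, abs_of_pos (pow_pos hR 2)]
    exact mul_le_mul_of_nonneg_left h1 (pow_pos hR 2).le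
  · right
    rw [vorticityDirection_curl_zoom hR]
    exact h2

end Zoom

end LeiRenTian2025

/-! ### Theorem 1.1 is equivalent to its apex form, and follows from the apex form under (1.6) -/

section Apex

open LeiRenTian2025

/-- For `z₀` in the closed cylinder `\overline{Q(1/2)} = [-1/4, 0] × \overline{B_{1/2}(0)}` the
backward cylinder `Q(z₀, 1/2)` lies in `Q(1)`. [folklore] -/
private theorem parabolicCylinder_half_subset_one_of_mem_closure {z₀ : ℝ × EuclideanSpace ℝ (Fin 3)}
    (hz₀ : z₀ ∈ closure (parabolicCylinder (1 / 2) (0 : ℝ × EuclideanSpace ℝ (Fin 3)))) :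
    parabolicCylinder (1 / 2) z₀ ⊆ parabolicCylinder 1 (0 : ℝ × EuclideanSpace ℝ (Fin 3)) := by
  rw [parabolicCylinder, closure_prod_eq, closure_Ioo (by norm_num), Prod.fst_zero, Prod.snd_zero,
    closure_ball _ (by norm_num)] at hz₀
  obtain ⟨ht, hx⟩ := hz₀
  rw [mem_Icc] at ht
  rw [mem_closedBall, dist_zero_right] at hx
  intro w hw
  rw [mem_parabolicCylinder] at hw ⊢
  obtain ⟨⟨hw1, hw2⟩, hw3⟩ := hw
  simp only [Prod.fst_zero, Prod.snd_zero, dist_zero_right]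
  refine ⟨⟨by nlinarith, by linarith⟩, ?_⟩
  calc ‖w.2‖ = dist w.2 0 := (dist_zero_right _).symm
    _ ≤ dist w.2 z₀.2 + dist z₀.2 0 := dist_triangle _ _ _
    _ < 1 / 2 + 1 / 2 := by
        rw [dist_zero_right]
        exact add_lt_add_of_lt_of_le hw3 hx
    _ = 1 := by norm_num

/-- **Theorem 1.1 ⇔ its apex form.** Lei–Ren–Tian's Thm. 1.1 as vendored (conclusion: every point
of the closed cylinder `\overline{Q(1/2)}` is regular) is equivalent to the same statement with
conclusion "the origin `(0, 0)` is a regular point": `0 ∈ \overline{Q(1/2)}` for one direction,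
and for the other a point `z₀ ∈ \overline{Q(1/2)}` has `Q(z₀, 1/2) ⊆ Q(1)`, so that the zoom
`U(s, y) = ½ u(t₀ + s/4, x₀ + y/2)` is again a local suitable weak solution in `Q(1)` satisfying the
hypotheses (with `M/4` in place of `M`), whose regularity at the origin is the regularity of `u` at
`z₀` (the paper proves regularity at the origin, p. 10 and §4, the translation being left to the
reader; cf. §3 ¶2 for the translated-and-rescaled solution).
[cite: LeiRenTian2025, Thm. 1.1 and its proof via Prop. 3.3 (arXiv:2501.08976, pp. 4, 8, 10)] -/
theorem LeiRenTian2025_doubleCone_regularity_iff_apex :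
    LeiRenTian2025_doubleCone_regularity ↔
      ∀ (u : ℝ → EuclideanSpace ℝ (Fin 3) → EuclideanSpace ℝ (Fin 3))
        (p : ℝ → EuclideanSpace ℝ (Fin 3) → ℝ) (e : EuclideanSpace ℝ (Fin 3)) (δ M : ℝ),
        IsSuitableWeakSolutionInBall 1 0 u p →
        IsClassicalAtRegularPoints u (parabolicCylinder 1 (0 : ℝ × EuclideanSpace ℝ (Fin 3))) →
        ‖e‖ = 1 → 0 < δ → 0 < M →
        (∀ z ∈ parabolicCylinder 1 (0 : ℝ × EuclideanSpace ℝ (Fin 3)), ¬ IsBackwardSingularPoint u z →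
          ‖curl (u z.1) z.2‖ ≤ M ∨
            ‖cross (vorticityDirection (curl (u z.1)) z.2) e‖ ≤ 1 - δ) →
        ¬ IsBackwardSingularPoint u 0 := by
  constructor
  · intro h u p e δ M hsw hcl he hδ hM hcone
    exact h u p e δ M hsw hcl he hδ hM hcone 0 subset_closure_of_mem_parabolicCylinder_zero
  · intro h u p e δ M hsw hcl he hδ hM hcone z₀ hz₀
    have hR : (0 : ℝ) < 1 / 2 := by norm_num
    have hsub := parabolicCylinder_half_subset_one_of_mem_closure hz₀
    have hsw' : IsSuitableWeakSolutionInBall (1 / 2) z₀ u p := hsw.of_subset_zero hR hsub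
    have hswU := hsw'.zoom hR
    have hpre : stAffine ((1 / 2 : ℝ) ^ 2) (1 / 2) z₀.1 z₀.2 ⁻¹' parabolicCylinder (1 / 2) z₀ =
        parabolicCylinder 1 (0 : ℝ × EuclideanSpace ℝ (Fin 3)) :=
      zoom_preimage_parabolicCylinder_self hR z₀
    have hclU : IsClassicalAtRegularPoints ((1 / 2 : ℝ) • stPull ((1 / 2 : ℝ) ^ 2) (1 / 2) z₀.1 z₀.2 u)
        (parabolicCylinder 1 (0 : ℝ × EuclideanSpace ℝ (Fin 3))) := by
      rw [← hpre]
      exact (hcl.mono hsub).zoom hR z₀.1 z₀.2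
    have hconeU := cone_zoom hR (t₁ := z₀.1) (x₁ := z₀.2) (e := e) (δ := δ) (M := M)
      (fun z hz hreg => hcone z (hsub hz) hreg)
    rw [hpre] at hconeU
    have key := h _ _ e δ ((1 / 2 : ℝ) ^ 2 * M) hswU hclU he hδ (by positivity) hconeU
    rw [isBackwardSingularPoint_zoom_iff hR] at key
    simpa [stAffine] using key
where
  /-- `0 ∈ \overline{Q(1/2)}`. -/
  subset_closure_of_mem_parabolicCylinder_zero :
      (0 : ℝ × EuclideanSpace ℝ (Fin 3)) ∈
        closure (parabolicCylinder (1 / 2) (0 : ℝ × EuclideanSpace ℝ (Fin 3))) := by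
    rw [parabolicCylinder, closure_prod_eq, closure_Ioo (by norm_num), Prod.fst_zero, Prod.snd_zero,
      closure_ball _ (by norm_num)]
    exact ⟨⟨by norm_num, le_rfl⟩, mem_closedBall_self (by norm_num)⟩

/-- **Theorem 1.1 from its apex form under the working hypothesis (1.6).** If every local suitable
weak solution `(u, p)` in `Q(1)` (canonically represented at its regular points) whose vorticity
satisfies `|ω| ≤ C |⟨ω, e⟩| + M` at all regular points of `Q(1)`, for some unit vector `e`,
`C ≥ 0` and `M > 0`, is regular at the origin, then `LeiRenTian2025_doubleCone_regularity` holds: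
by Remark 1.2 the cone dichotomy "`|ω| ≤ M` or `|ξ × e| ≤ 1 - δ`" implies (1.6) with
`C = 1/√(δ(2-δ))` (`LeiRenTian2025.norm_le_of_dichotomy`), and the apex form implies the
closed-cylinder form (`LeiRenTian2025_doubleCone_regularity_iff_apex`). The hypothesis `h` is the
analytic content of the paper (Lemmas 3.1–3.2, the blow-up procedure, Prop. 3.3 and §4), which is
not proved in this file.
[cite: LeiRenTian2025, Rmk. 1.2 (1.6) and the proof of Thm. 1.1 (arXiv:2501.08976, pp. 4, 8–12)] -/
theorem LeiRenTian2025_doubleCone_regularity_of_apex_linearCone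
    (h : ∀ (u : ℝ → EuclideanSpace ℝ (Fin 3) → EuclideanSpace ℝ (Fin 3))
        (p : ℝ → EuclideanSpace ℝ (Fin 3) → ℝ) (e : EuclideanSpace ℝ (Fin 3)) (C M : ℝ),
        IsSuitableWeakSolutionInBall 1 0 u p →
        IsClassicalAtRegularPoints u (parabolicCylinder 1 (0 : ℝ × EuclideanSpace ℝ (Fin 3))) →
        ‖e‖ = 1 → 0 ≤ C → 0 < M →
        (∀ z ∈ parabolicCylinder 1 (0 : ℝ × EuclideanSpace ℝ (Fin 3)), ¬ IsBackwardSingularPoint u z →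
          ‖curl (u z.1) z.2‖ ≤ C * |⟪curl (u z.1) z.2, e⟫_ℝ| + M) →
        ¬ IsBackwardSingularPoint u 0) :
    LeiRenTian2025_doubleCone_regularity := by
  refine LeiRenTian2025_doubleCone_regularity_iff_apex.2 fun u p e δ M hsw hcl he hδ hM hcone => ?_
  refine h u p e (Real.sqrt (δ * (2 - δ)))⁻¹ M hsw hcl he (by positivity) hM fun z hz hreg => ?_
  exact norm_le_of_dichotomy he hδ hM.le (hcone z hz hreg)

end Apex

end Literature.Analysis.FluidPDE

end
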